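import Mathlib.RingTheory.MvPolynomial.Basic
import Mathlib.Algebra.MvPolynomial.CommRing
import Mathlib.Algebra.MvPolynomial.Monad
import Mathlib.Algebra.Polynomial.AlgebraMap
import Mathlib.FieldTheory.Finite.Basic
import HarnessLib

/-!
# The weight-comparison functional «coefficient of `X₀ⁿ`» on binary forms is scaled by `aⁿ` under an
# upper-triangular substitution — hence `Γ₀(p)`-INVARIANT mod `p` in weights `k ≡ 2 (mod p − 1)`:
# MEMO-24 §1 (a)(ii) («CHECKED in-run on generators») as a kernel theorem (cell `bsd-eis`, seat
# `bsd-line-x2-p2` gen 2, D-0154 KEY row 5; route `EisensteinPrimes`, crux 4 `BSDpOnCellC`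
# stmt-BirchSwinnertonDyer-19034 line b1 v10 / crux 3; memo `HOME/cgshw-MEMO-24.md` §1 (a)(ii);
# companions p606630, p610475, p611136)

HONEST FRAMING (cell `bsd-eis`, run/shared/lean/pub/bsd-eis/): pure algebra of two-variable polynomials
over a commutative ring / over `𝔽_p` (Mathlib only); NO modular symbol, coefficient sheaf or Hecke
operator is constructed — the memo's use («`π_*φ̄_g ∈ Symb_{Γ₀(N)}(𝔽₃)⁺[𝔪]`», the Ash–Stevens / Hida
comparison P-LINE 2) stays memo-level; nothing is booked; no label or count moves; BSD and the main
conjectures are proved for no curve. Helper attached to stmt-BirchSwinnertonDyer-19034 (`--supports`).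

## The point

MEMO-24 §1 (a)(ii): «the weight comparison `π : Sym^{k−2}(𝔽₃) → 𝔽₃`, coefficient of the `∫·dz` monomial,
is `Γ₀(3)`-equivariant mod 3 for even `k` (cross terms carry the lower-left entry `c ≡ 0`, the diagonal
factor is `a^{k−2} ≡ 1`; CHECKED in-run on generators)». In the kernel, for binary forms realised as
`MvPolynomial (Fin 2) R` with the substitution `X₀ ↦ a·X₀ + b·X₁`, `X₁ ↦ c·X₀ + d·X₁`:

* §1 `polynomial_coeff_comp_C_mul_X` — `[Xⁿ](q ∘ (aX)) = aⁿ·[Xⁿ]q` (univariate).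
* §2 `coeff_single_zero_eq_coeff_aeval` — the `X₀ⁿ`-coefficient of `P` is the `Xⁿ`-coefficient of
  `P(X, 0)` (kill `X₁`).
* §3 **`coeff_X₀_pow_bind₁_of_lowerLeft_eq_zero`** — if `c = 0` then
  `[X₀ⁿ](P ∘ γ) = aⁿ · [X₀ⁿ]P` for EVERY `P` (no homogeneity needed): the cross terms die with `c`, the
  diagonal contributes `aⁿ`.
* §4 **`coeff_X₀_pow_bind₁_eq_of_dvd`** — over `𝔽_p` with `a ≠ 0` and `(p − 1) ∣ n`: the functional is
  INVARIANT (`a^{p−1} = 1`); `coeff_X₀_pow_bind₁_eq_of_even` — `p = 3`, `n` even: the memo's case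
  (every even weight `k`, `n = k − 2`), now a theorem rather than a run-time check.

References: [AshStevens1986] Thm. 3.4 (the comparison the functional feeds, memo level);
[Hida1986] (ordinary cohomology across weights, memo level); cell memo cgshw MEMO-24 §1 (a)(ii)
e922e989f5e38c02.
-/

set_option autoImplicit false
set_option linter.dupNamespace false -- the summit namespace `…BirchSwinnertonDyer.BirchSwinnertonDyer.Theorems` (Sub = Summit, D-0017) trips it

noncomputable section

open scoped Classical

open MvPolynomial

namespace Summit.BirchSwinnertonDyer.BirchSwinnertonDyer.Theorems.WeightComparisonFunctional

variable {R : Type*} [CommRing R]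

/-! ## §1. Univariate: `[Xⁿ](q ∘ (aX)) = aⁿ·[Xⁿ]q` -/

/-- `[Xⁿ](q(aX)) = aⁿ·[Xⁿ]q` for a univariate polynomial `q`. [folklore] -/
theorem polynomial_coeff_comp_C_mul_X (q : Polynomial R) (a : R) (n : ℕ) :
    (q.comp (Polynomial.C a * Polynomial.X)).coeff n = a ^ n * q.coeff n := by
  induction q using Polynomial.induction_on' with
  | add p q hp hq =>
      rw [Polynomial.add_comp, Polynomial.coeff_add, Polynomial.coeff_add, hp, hq, mul_add]
  | monomial k c =>
      rw [Polynomial.monomial_comp, mul_pow, ← map_pow, ← mul_assoc, ← map_mul,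
        Polynomial.coeff_C_mul_X_pow, Polynomial.coeff_monomial]
      by_cases h : n = k
      · subst h; simp [mul_comm]
      · rw [if_neg h, if_neg (Ne.symm h), mul_zero]

/-! ## §2. The `X₀ⁿ`-coefficient is read after killing `X₁` -/

/-- The `X₀ⁿ`-coefficient of a two-variable polynomial `P` equals the `Xⁿ`-coefficient of `P(X, 0)`.
[folklore] -/
theorem coeff_single_zero_eq_coeff_aeval (P : MvPolynomial (Fin 2) R) (n : ℕ) :
    coeff (Finsupp.single (0 : Fin 2) n) P =
      (aeval ![Polynomial.X, (0 : Polynomial R)] P).coeff n := by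
  induction P using MvPolynomial.induction_on' with
  | add p q hp hq => rw [coeff_add, map_add, Polynomial.coeff_add, hp, hq]
  | monomial s r =>
      rw [coeff_monomial, aeval_monomial, Finsupp.prod_fintype _ _ (fun i ↦ by rw [pow_zero]),
        Fin.prod_univ_two]
      simp only [Matrix.cons_val_zero, Matrix.cons_val_one]
      by_cases h1 : s 1 = 0
      · rw [h1, pow_zero, mul_one, Polynomial.algebraMap_eq, Polynomial.coeff_C_mul_X_pow]
        have key : s = Finsupp.single 0 n ↔ n = s 0 := by
          constructor
          · intro h; rw [h]; simp
          · intro h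
            subst h
            ext i
            fin_cases i
            · simp
            · simpa using h1
        by_cases hn : n = s 0
        · rw [if_pos (key.mpr hn), if_pos hn]
        · rw [if_neg (mt key.mp hn), if_neg hn]
      · have hne : s ≠ Finsupp.single (0 : Fin 2) n := by
          intro h; apply h1; rw [h]; simp
        rw [if_neg hne, zero_pow h1, mul_zero, mul_zero, Polynomial.coeff_zero]

/-! ## §3. Upper-triangular substitutions scale the functional by `aⁿ` -/

/-- **`[X₀ⁿ](P ∘ γ) = aⁿ·[X₀ⁿ]P` when the lower-left entry vanishes.** For the substitution
`X₀ ↦ a·X₀ + b·X₁`, `X₁ ↦ c·X₀ + d·X₁` with `c = 0` (MEMO-24: «cross terms carry the lower-left entry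
`c ≡ 0`, the diagonal factor is `a^{k−2}`»), and EVERY `P` (no homogeneity needed). [folklore] -/
theorem coeff_X₀_pow_bind₁_of_lowerLeft_eq_zero (a b c d : R) (hc : c = 0) (n : ℕ)
    (P : MvPolynomial (Fin 2) R) :
    coeff (Finsupp.single (0 : Fin 2) n) (bind₁ ![C a * X 0 + C b * X 1, C c * X 0 + C d * X 1] P) =
      a ^ n * coeff (Finsupp.single (0 : Fin 2) n) P := by
  subst hc
  calc coeff (Finsupp.single (0 : Fin 2) n) (bind₁ ![C a * X 0 + C b * X 1, C 0 * X 0 + C d * X 1] P)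
      = (aeval ![Polynomial.X, (0 : Polynomial R)]
          (bind₁ ![C a * X 0 + C b * X 1, C 0 * X 0 + C d * X 1] P)).coeff n :=
        coeff_single_zero_eq_coeff_aeval _ n
    _ = (aeval ![Polynomial.C a * Polynomial.X, (0 : Polynomial R)] P).coeff n := by
        -- killing `X₁` after the substitution = substituting `X₀ ↦ aX`, `X₁ ↦ 0`
        congr 1
        rw [← aeval_eq_bind₁, ← AlgHom.comp_apply, comp_aeval]
        congr 2
        funext i
        fin_cases i <;> simp [Polynomial.algebraMap_eq]
    _ = (((aeval ![Polynomial.X, (0 : Polynomial R)]) P).comp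
          (Polynomial.C a * Polynomial.X)).coeff n := by
        -- substituting `X₀ ↦ aX`, `X₁ ↦ 0` = killing `X₁`, then `X ↦ aX`
        congr 1
        rw [Polynomial.comp_eq_aeval, ← AlgHom.comp_apply, comp_aeval]
        congr 2
        funext i
        fin_cases i <;> simp
    _ = a ^ n * ((aeval ![Polynomial.X, (0 : Polynomial R)]) P).coeff n :=
        polynomial_coeff_comp_C_mul_X _ a n
    _ = a ^ n * coeff (Finsupp.single (0 : Fin 2) n) P := by rw [coeff_single_zero_eq_coeff_aeval P n]

/-! ## §4. Mod `p`: invariance in weights `k ≡ 2 (mod p − 1)`; `p = 3`, every even weight -/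

/-- **The functional is `Γ₀(p)`-INVARIANT mod `p` when `(p − 1) ∣ n`.** Over `𝔽_p`, for a substitution
with lower-left entry `0` and diagonal entry `a ≠ 0` (the reduction of any `γ ∈ Γ₀(N)`, `p ∣ N`):
`[X₀ⁿ](P ∘ γ) = [X₀ⁿ]P` as soon as `(p − 1) ∣ n` (`a^{p−1} = 1`). With `n = k − 2` this is MEMO-24
§1 (a)(ii) for weights `k ≡ 2 (mod p − 1)`. [folklore] -/
theorem coeff_X₀_pow_bind₁_eq_of_dvd {p : ℕ} [Fact p.Prime] (a b c d : ZMod p) (ha : a ≠ 0)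
    (hc : c = 0) {n : ℕ} (hn : (p - 1) ∣ n) (P : MvPolynomial (Fin 2) (ZMod p)) :
    coeff (Finsupp.single (0 : Fin 2) n) (bind₁ ![C a * X 0 + C b * X 1, C c * X 0 + C d * X 1] P) =
      coeff (Finsupp.single (0 : Fin 2) n) P := by
  obtain ⟨m, rfl⟩ := hn
  rw [coeff_X₀_pow_bind₁_of_lowerLeft_eq_zero a b c d hc, pow_mul,
    ZMod.pow_card_sub_one_eq_one ha, one_pow, one_mul]

/-- **`p = 3`: the functional is `Γ₀(3)`-invariant mod 3 in EVERY even degree `n = k − 2`** — the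
memo's case («for even `k`»), previously «CHECKED in-run on generators», now a theorem. [folklore] -/
theorem coeff_X₀_pow_bind₁_eq_of_even (a b c d : ZMod 3) (ha : a ≠ 0) (hc : c = 0) {n : ℕ}
    (hn : Even n) (P : MvPolynomial (Fin 2) (ZMod 3)) :
    coeff (Finsupp.single (0 : Fin 2) n) (bind₁ ![C a * X 0 + C b * X 1, C c * X 0 + C d * X 1] P) =
      coeff (Finsupp.single (0 : Fin 2) n) P :=
  haveI : Fact (Nat.Prime 3) := ⟨Nat.prime_three⟩
  coeff_X₀_pow_bind₁_eq_of_dvd a b c d ha hc (by simpa using hn.two_dvd) P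

end Summit.BirchSwinnertonDyer.BirchSwinnertonDyer.Theorems.WeightComparisonFunctional

end
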